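import Summits.KontsevichZagierPeriods.KontsevichZagierPeriods.Theses.FurushoPentagon
import Summits.KontsevichZagierPeriods.KontsevichZagierPeriods.Theorems.FurushoPentagonReducedPeriodRingDefs
import Literature.NumberTheory.Transcendental.KZCubicalCalculus
import Literature.NumberTheory.Transcendental.KZLogCalculusProofs
import Summits.KontsevichZagierPeriods.KontsevichZagierPeriods.Theorems.FurushoPentagonSectorToKernelStokesSpanCalibration
import Literature.NumberTheory.Transcendental.KZSemiCanonicalReductionProofs
import Literature.NumberTheory.Transcendental.KZTameMoveFamily
import Literature.NumberTheory.Transcendental.SemialgebraicMapsProofs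
import Literature.NumberTheory.Transcendental.KZMellinFibres

/-!
# `SectorToKernel`, line `effective-cube-surjection`, dimension-one rung: one piece is a tame cube class

Stub R4 `stub_pieceToTameCube` of the dimension-one rung of the resolution stub S1 of the crux
`FurushoPentagon.SectorToKernel` (stmt-KontsevichZagierPeriods-10813).

Let `u = [(0,1), f]` be an integral representation on the open unit interval of `ℝ¹`, `0 < e`, and
`H` a function analytic on a neighbourhood of `[0, 1]` with `H t = f(tᵉ) · e tᵉ⁻¹` on `(0, 1)`.
Then `[u]` is KZ-equivalent to the tame cube class `[[0,1], H]`: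

* the power substitution `s = tᵉ` is Kontsevich–Zagier's rule (2) along the Kummer covering
  `x₀ ↦ x₀ᵉ` of `(0,1)` (`KZ.of_sub_of_mem_relations_of_boxDilation`, an instance of
  `KZ.changeOfVariablesRel`), giving `[(0,1), H ∘ x₀] − [(0,1), f] ∈ relations`;
* `[(0,1), H ∘ x₀] − [[0,1], H ∘ x₀] ∈ relations`, the two endpoints being Lebesgue-null
  (`KZ.of_sub_of_mem_relations_of_null`);
* `H ∘ x₀` is analytic near the closed cube and `ℚ`-semialgebraic on it — on the open piece it is the
  pull-back of `f` along a polynomial map times a polynomial, and semialgebraicity passes to the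
  closure of the piece by continuity (`stokesCal_isSemialgebraicFunOn_of_subset_closure`) — so
  `[[0,1], H ∘ x₀] = [IntegralRep.tameCube (H ∘ x₀)]` is a tame cube class (`cubicalGens`).

References: M. Kontsevich, D. Zagier, *Periods* (2001), §1.2, rules (1), (2);
J. Bochnak, M. Coste, M.-F. Roy, *Real Algebraic Geometry* (1998), Prop. 2.2.6.
-/

noncomputable section

namespace Summit.KontsevichZagierPeriods.FurushoPentagon.SectorToKernel

open Set MeasureTheory
open Literature.NumberTheory.Transcendental
open Literature.NumberTheory.Transcendental.KZ hiding cubicalSpan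
open Summit.KontsevichZagierPeriods.KontsevichZagierPeriods.Theses.FurushoPentagon
open Summit.KontsevichZagierPeriods.FurushoPentagon.ReducedPeriodRing (unitCube cubicalGens cubicalSpan)

/-! ### The power map `x ↦ x₀ᵉ` on `ℝ¹` -/

/-- On `ℝ¹` the box dilation of order `e` of the (only) coordinate is the power map `x ↦ (x₀ᵉ)`.
[folklore] -/
theorem piece_boxDilation_eq {e : ℕ} (he : 0 < e) (x : Fin 1 → ℝ) :
    boxDilation (0 : Fin 1) (e - 1) x = fun _ => x 0 ^ e := by
  funext i
  rw [Subsingleton.elim i 0, boxDilation_apply_self, Nat.sub_add_cancel he]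

/-- The power map `x ↦ x₀ᵉ` (`0 < e`) carries the open unit interval of `ℝ¹` onto itself (the inverse
being `y ↦ y₀^{1/e}`). [folklore] -/
theorem piece_image_boxDilation {e : ℕ} (he : 0 < e) :
    boxDilation (0 : Fin 1) (e - 1) '' {x : Fin 1 → ℝ | x 0 ∈ Set.Ioo (0:ℝ) 1} =
      {x : Fin 1 → ℝ | x 0 ∈ Set.Ioo (0:ℝ) 1} := by
  have he' : e ≠ 0 := Nat.pos_iff_ne_zero.1 he
  ext y
  constructor
  · rintro ⟨x, hx, rfl⟩
    show boxDilation (0 : Fin 1) (e - 1) x 0 ∈ Set.Ioo (0:ℝ) 1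
    rw [piece_boxDilation_eq he]
    exact ⟨pow_pos hx.1 e, pow_lt_one₀ hx.1.le hx.2 he'⟩
  · intro hy
    refine ⟨fun _ => y 0 ^ ((e : ℝ)⁻¹), ?_, ?_⟩
    · exact ⟨Real.rpow_pos_of_pos hy.1 _, Real.rpow_lt_one hy.1.le hy.2 (by positivity)⟩
    · rw [piece_boxDilation_eq he]
      funext i
      rw [Subsingleton.elim i 0]
      exact Real.rpow_inv_natCast_pow hy.1.le he'

/-! ### The open piece inside the closed cube -/

/-- The open unit interval of `ℝ¹` lies in the closed unit cube. [folklore] -/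
theorem piece_subset_cube : {x : Fin 1 → ℝ | x 0 ∈ Set.Ioo (0:ℝ) 1} ⊆ KZ.cube 1 := fun x hx =>
  KZ.mem_cube.2 fun i => by
    rw [Subsingleton.elim i 0]
    exact ⟨hx.1.le, hx.2.le⟩

/-- The closed unit cube of `ℝ¹` lies in the closure of the open unit interval. [folklore] -/
theorem piece_cube_subset_closure :
    KZ.cube 1 ⊆ closure {x : Fin 1 → ℝ | x 0 ∈ Set.Ioo (0:ℝ) 1} := by
  have hpi : {x : Fin 1 → ℝ | x 0 ∈ Set.Ioo (0:ℝ) 1} = Set.pi univ (fun _ : Fin 1 => Ioo (0:ℝ) 1) := by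
    ext x
    simp only [mem_setOf_eq, mem_univ_pi, Fin.forall_fin_one]
  rw [hpi, closure_pi_set, KZ.cube_eq_pi]
  intro x hx
  rw [mem_univ_pi] at hx ⊢
  intro i
  rw [closure_Ioo (zero_ne_one : (0:ℝ) ≠ 1)]
  exact hx i

/-- The closed unit cube of `ℝ¹` exceeds the open unit interval by a null set (the two endpoints).
[folklore] -/
theorem piece_volume_cube_diff :
    volume (KZ.cube 1 \ {x : Fin 1 → ℝ | x 0 ∈ Set.Ioo (0:ℝ) 1}) = 0 := by
  refine measure_mono_null (fun z hz => ?_)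
    (((Set.finite_singleton (fun _ : Fin 1 => (1:ℝ))).insert (fun _ => (0:ℝ))).measure_zero volume)
  have h0 : 0 ≤ z 0 ∧ z 0 ≤ 1 := KZ.mem_cube.1 hz.1 0
  have h1 : ¬ (0 < z 0 ∧ z 0 < 1) := hz.2
  simp only [mem_insert_iff, mem_singleton_iff]
  rcases h0.1.eq_or_lt with h | h
  · exact Or.inl (funext fun i => by rw [Subsingleton.elim i 0]; exact h.symm)
  · exact Or.inr (funext fun i => by
      rw [Subsingleton.elim i 0]
      exact h0.2.eq_or_lt.resolve_right fun h' => h1 ⟨h, h'⟩)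

/-! ### The extension `H ∘ x₀`: analytic near the cube, semialgebraic on the open piece -/

/-- A function analytic on a neighbourhood of `[0, 1]`, read on `ℝ¹` through the coordinate `x₀`, is
analytic on a neighbourhood of the closed unit cube. [folklore] -/
theorem piece_analyticOnNhd {H : ℝ → ℝ} (hH : AnalyticOnNhd ℝ H (Set.Icc (0:ℝ) 1)) :
    AnalyticOnNhd ℝ (fun x : Fin 1 → ℝ => H (x 0)) (KZ.cube 1) := by
  intro x hx
  have h0 : 0 ≤ x 0 ∧ x 0 ≤ 1 := KZ.mem_cube.1 hx 0
  have hp : AnalyticAt ℝ (fun y : Fin 1 → ℝ => y 0) x :=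
    (ContinuousLinearMap.proj (R := ℝ) (φ := fun _ : Fin 1 => ℝ) 0).analyticAt x
  exact AnalyticAt.comp (g := H) (f := fun y : Fin 1 → ℝ => y 0) (hH (x 0) ⟨h0.1, h0.2⟩) hp

/-- On the open piece `(0,1) ⊆ ℝ¹`, the substituted integrand `x ↦ f(x₀ᵉ) · e x₀ᵉ⁻¹` of a
representation `u = [(0,1), f]` is `ℚ`-semialgebraic — the pull-back of `f` along the polynomial map
`x ↦ x₀ᵉ` (`IsSemialgebraicFunOn.comp_aeval`) times a polynomial (`IsSemialgebraicFunOn.mul_holds`) —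
hence so is every function `H ∘ x₀` agreeing with it there. [Bochnak–Coste–Roy 1998, Prop. 2.2.6] -/
theorem piece_isSemialgebraicFunOn_Ioo (u : IntegralRep 1) {e : ℕ} {H : ℝ → ℝ} (he : 0 < e)
    (hu : u.domain = {x : Fin 1 → ℝ | x 0 ∈ Set.Ioo (0:ℝ) 1})
    (hH : ∀ t ∈ Set.Ioo (0:ℝ) 1, H t = u.integrand (fun _ => t ^ e) * ((e : ℝ) * t ^ (e - 1))) :
    IsSemialgebraicFunOn ℚ {x : Fin 1 → ℝ | x 0 ∈ Set.Ioo (0:ℝ) 1} (fun x => H (x 0)) := by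
  have hDsa : Literature.ModelTheory.ExponentialFields.IsSemialgebraic ℚ
      {x : Fin 1 → ℝ | x 0 ∈ Set.Ioo (0:ℝ) 1} := hu ▸ u.isSemialgebraic_domain
  -- pull-back of the integrand along `x ↦ x₀ ^ e`
  have h1 : IsSemialgebraicFunOn ℚ {x : Fin 1 → ℝ | x 0 ∈ Set.Ioo (0:ℝ) 1}
      (fun x => u.integrand (boxDilation (0 : Fin 1) (e - 1) x)) := by
    have h := u.isSemialgebraicFunOn_integrand.comp_aeval (dilateSubst (0 : Fin 1) (e - 1))
    refine (h.mono (fun x hx => ?_) hDsa).congr (fun x _ => ?_)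
    · show (fun j => MvPolynomial.aeval x (dilateSubst (0 : Fin 1) (e - 1) j)) ∈ u.domain
      rw [aeval_dilateSubst_eq, hu, ← piece_image_boxDilation he]
      exact mem_image_of_mem _ hx
    · show u.integrand (fun j => MvPolynomial.aeval x (dilateSubst (0 : Fin 1) (e - 1) j)) =
        u.integrand (boxDilation (0 : Fin 1) (e - 1) x)
      rw [aeval_dilateSubst_eq]
  -- the Jacobian factor `e x₀ ^ (e - 1)`
  have h2 : IsSemialgebraicFunOn ℚ {x : Fin 1 → ℝ | x 0 ∈ Set.Ioo (0:ℝ) 1}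
      (fun x => (e : ℝ) * x 0 ^ (e - 1)) := by
    refine (isSemialgebraicFunOn_aeval hDsa
      (MvPolynomial.C (e : ℚ) * MvPolynomial.X 0 ^ (e - 1) : MvPolynomial (Fin 1) ℚ)).congr
      (fun x _ => ?_)
    simp only [map_mul, map_pow, MvPolynomial.aeval_C, MvPolynomial.aeval_X, eq_ratCast,
      Rat.cast_natCast]
  refine (IsSemialgebraicFunOn.mul_holds h1 h2).congr (fun x hx => ?_)
  show u.integrand (boxDilation (0 : Fin 1) (e - 1) x) * ((e : ℝ) * x 0 ^ (e - 1)) = H (x 0)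
  rw [hH (x 0) hx, piece_boxDilation_eq he]

/-! ### The stub -/

/-- **R4 (one normalised piece is a tame cube class).** A representation on the open unit interval whose
integrand becomes, after the power substitution `s = tᵉ` (a rule-(2) move with Jacobian `e tᵉ⁻¹`), the
restriction of a function analytic on a neighbourhood of `[0, 1]`, is KZ-equivalent to a tame cube class
(null modification at the two endpoints; semialgebraicity of the extension by closure of the graph).
[Kontsevich–Zagier 2001, §1.2 rules (1), (2)] -/
theorem stub_pieceToTameCube :
    ∀ (u : IntegralRep 1) (e : ℕ) (H : ℝ → ℝ), 0 < e → u.domain = {x : Fin 1 → ℝ | x 0 ∈ Set.Ioo (0:ℝ) 1} → AnalyticOnNhd ℝ H (Set.Icc (0:ℝ) 1) → (∀ t ∈ Set.Ioo (0:ℝ) 1, H t = u.integrand (fun _ => t ^ e) * ((e : ℝ) * t ^ (e - 1))) → ∃ c : FormalRep, c ∈ cubicalSpan ∧ of u - c ∈ relations := by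
  intro u e H he hu hHa hH
  have hDsa : Literature.ModelTheory.ExponentialFields.IsSemialgebraic ℚ
      {x : Fin 1 → ℝ | x 0 ∈ Set.Ioo (0:ℝ) 1} := hu ▸ u.isSemialgebraic_domain
  -- `h = H ∘ x₀` is analytic near the cube and `ℚ`-semialgebraic on it
  have hha : AnalyticOnNhd ℝ (fun x : Fin 1 → ℝ => H (x 0)) (KZ.cube 1) := piece_analyticOnNhd hHa
  have hsaD : IsSemialgebraicFunOn ℚ {x : Fin 1 → ℝ | x 0 ∈ Set.Ioo (0:ℝ) 1} (fun x => H (x 0)) :=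
    piece_isSemialgebraicFunOn_Ioo u he hu hH
  have hsa : IsSemialgebraicFunOn ℚ (KZ.cube 1) (fun x : Fin 1 → ℝ => H (x 0)) :=
    stokesCal_isSemialgebraicFunOn_of_subset_closure hsaD piece_subset_cube
      piece_cube_subset_closure KZ.isCompact_cube hha.continuousOn
  -- the tame cube class `[[0,1], h]`
  refine ⟨of (IntegralRep.tameCube _ hha hsa),
    AddSubgroup.subset_closure ⟨1, IntegralRep.tameCube _ hha hsa, rfl, hha, rfl⟩, ?_⟩
  -- the substituted representation `v = [(0,1), h]`
  obtain ⟨v, hvd, hvi⟩ : ∃ v : IntegralRep 1,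
      v.domain = {x : Fin 1 → ℝ | x 0 ∈ Set.Ioo (0:ℝ) 1} ∧ v.integrand = fun x => H (x 0) :=
    ⟨⟨_, _, hDsa, hsaD, (hha.continuousOn.integrableOn_compact KZ.isCompact_cube).mono_set
      piece_subset_cube⟩, rfl, rfl⟩
  -- `[v] ∼ [[0,1], h]`: the endpoints are null
  have h1 : of v - of (IntegralRep.tameCube _ hha hsa) ∈ relations := by
    refine of_sub_of_mem_relations_of_null v _ ?_ ?_ ?_
    · rw [hvd, IntegralRep.tameCube_domain, Set.sdiff_eq_empty.mpr piece_subset_cube, measure_empty]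
    · rw [hvd, IntegralRep.tameCube_domain]
      exact piece_volume_cube_diff
    · rw [hvi, IntegralRep.tameCube_integrand]
      exact fun _ _ => rfl
  -- `[v] ∼ [u]`: rule (2) along `x₀ ↦ x₀ᵉ`
  have h2 : of v - of u ∈ relations := by
    refine of_sub_of_mem_relations_of_boxDilation (0 : Fin 1) (e - 1)
      (fun x hx => ?_) ?_ (fun x hx => ?_)
    · rw [hvd] at hx
      exact hx.1
    · rw [hvd, hu, piece_image_boxDilation he]
    · rw [hvd] at hx
      rw [hvi]
      show H (x 0) = _
      rw [hH (x 0) hx, piece_boxDilation_eq he, Nat.sub_add_cancel he]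
  have : of u - of (IntegralRep.tameCube _ hha hsa) =
      (of v - of (IntegralRep.tameCube _ hha hsa)) - (of v - of u) := by abel
  rw [this]
  exact relations.sub_mem h1 h2

end Summit.KontsevichZagierPeriods.FurushoPentagon.SectorToKernel
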